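import Summits.CriticalPhenomena.CardyFormulaZ2.Theses.CardyBoundaryCoulombGas
import Literature.Probability.RandomPlanarGeometry.RectangleModulusLambda
import Literature.Probability.RandomPlanarGeometry.ConformalRectangleProofs
import Literature.Probability.RandomPlanarGeometry.KlebanZagierTheorem2
import Literature.Probability.Percolation.CardyFormula

/-!
# `RectilinearCardy → stub_rectCardyOne`, part 3: assembly

Support file for line `two-cluster-rate-is-stationary-gap` (crux `StripClusterRates`,
stmt-CriticalPhenomena-13878). The `γ₁` half of the strip-rate statement consumes Cardy's value
`F(λ(iA))` (`F = cardyFunction`, `λ(iA) = KlebanZagier.lamR A` the conformal modulus of the `A × 1`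
rectangle) for the lattice rectangles `(A·k−2) × (k−2)` as `k → ∞` (`stub_rectCardyOne`). This file is
the pure assembly `rc_rectCardyOne_of_parts` of that value from three inputs, all taken as hypotheses
in their registered shapes:

1. (`rc_exists_boxRect`, landed separately) for every integer aspect `A ≥ 1` a conformal rectangle `R`
   with carrier the open box `(0,A)×(0,1)`, arcs `0`/`2` its left/right sides, corner marks
   `i, 0, A, A + i` and a rectilinear frontier;
2. (`rc_box_dictionary`, landed separately) for such an `R` and `k ≥ 2`, Smirnov's discretised crossing
   probability at mesh `1/k` is the left-right crossing probability of the lattice box: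
   `bondDomainCrossingProb R (1/k) = crossingProb half (A k − 2) (k − 2)`;
3. the route's crux 4 `RectilinearCardy` (Cardy's formula for every rectilinear conformal rectangle).

Proof: crux 4 applied to the rectangle of (1) gives `R.HasCrossingLimit (bondDomainCrossingProb R) F`;
evaluate it at a uniformizing datum (`MarkedDomain.exists_isUniformizing_holds`, Riemann mapping +
Carathéodory, theorems of the tree), identify the cross-ratio of that datum with `λ(iA)`
(`rectangle_crossRatio_eq_lamR`, Kleban–Zagier 2003 §3), compose the `δ → 0⁺` limit with the mesh
sequence `δ = 1/k → 0⁺`, and replace the discretised crossing probability by the lattice one for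
`k ≥ 2` using (2). No definitions are introduced.

References: J. Cardy, J. Phys. A 25 (1992) L201 [CardyJPhysA1992]; P. Kleban, D. Zagier,
J. Stat. Phys. 113 (2003) 431, §3 [KlebanZagier2003]; S. Smirnov, C. R. Acad. Sci. Paris 333 (2001)
239, Thm 1 [Smirnov2001]; B. Bollobás, O. Riordan, *Percolation* (2006), Ch. 7 §7.1
[BollobasRiordan2006].
-/

noncomputable section

namespace Summit.CriticalPhenomena.CardyFormulaZ2.Cruxes.StripClusterRates.TwoClusterRateIsStationaryGap

open Set Filter
open scoped Topology
open Literature.Probability.RandomPlanarGeometry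
open Literature.Probability.Percolation (bondDomainCrossingProb crossingProb half)
open Summit.CriticalPhenomena.CardyFormulaZ2.Theses.CardyBoundaryCoulombGas (RectilinearCardy)

namespace RectCardyOneOfParts

/-- The mesh sequence `δ_k = 1/k` tends to `0` from the right: `1/k → 0` within `(0, ∞)` along
`k → ∞` (it is eventually, indeed for `k ≥ 1`, positive). [folklore] -/
theorem tendsto_one_div_nat_nhdsWithin_Ioi :
    Tendsto (fun k : ℕ ↦ 1 / (k : ℝ)) atTop (𝓝[>] 0) := by
  refine tendsto_nhdsWithin_iff.mpr ⟨tendsto_one_div_atTop_nhds_zero_nat, ?_⟩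
  filter_upwards [eventually_gt_atTop 0] with k hk
  exact Set.mem_Ioi.mpr (one_div_pos.mpr (Nat.cast_pos.mpr hk))

/-- **Cardy's value along the mesh sequence.** If a conformal rectangle `R` has crossing limit `F`
for the family `p` (`p δ → F η` as `δ → 0⁺`, `η` the cross-ratio of any uniformizing datum) and
`(φ, x)` is a uniformizing datum, then `p (1/k) → F (crossRatio x)` as `k → ∞`. [folklore] -/
theorem tendsto_comp_one_div_of_hasCrossingLimit {R : ConformalRectangle} {p F : ℝ → ℝ}
    (hR : R.HasCrossingLimit p F) {φ : ConformalEquiv UpperHalfPlane.upperHalfPlaneSet R.carrier}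
    {x : Fin 4 → ℝ} (hφx : R.IsUniformizing φ x) :
    Tendsto (fun k : ℕ ↦ p (1 / (k : ℝ))) atTop (𝓝 (F (crossRatio x))) :=
  (hR φ x hφx).comp tendsto_one_div_nat_nhdsWithin_Ioi

end RectCardyOneOfParts

/-- **Assembly `rc_rectCardyOne_of_parts`** (registered sub-goal of line
`two-cluster-rate-is-stationary-gap`): the existence of the corner-marked rectilinear box `(0,A)×(0,1)`
with left/right crossing arcs (`rc_exists_boxRect`), the event dictionary
`bondDomainCrossingProb R (1/k) = crossingProb half (A k − 2) (k − 2)` (`rc_box_dictionary`) and the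
route's crux `RectilinearCardy` together give Cardy's value for the lattice rectangles:
`crossingProb half (A k − 2) (k − 2) → cardyFunction (λ(iA))` as `k → ∞`, for every integer aspect
`A ≥ 1`. [folklore] -/
theorem rc_rectCardyOne_of_parts :
    (∀ A : ℕ, 1 ≤ A → ∃ R : Literature.Probability.RandomPlanarGeometry.ConformalRectangle,
      R.carrier = (Set.Ioo (0 : ℝ) A ×ℂ Set.Ioo (0 : ℝ) 1) ∧
      R.arc 0 = {z : ℂ | z.re = 0 ∧ z.im ∈ Set.Icc (0 : ℝ) 1} ∧
      R.arc 2 = {z : ℂ | z.re = A ∧ z.im ∈ Set.Icc (0 : ℝ) 1} ∧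
      (R.pt 0 = ((1 : ℝ) : ℂ) * Complex.I ∧ R.pt 1 = 0 ∧ R.pt 2 = ((A : ℝ) : ℂ) ∧
        R.pt 3 = ((A : ℝ) : ℂ) + ((1 : ℝ) : ℂ) * Complex.I) ∧
      (∃ S : Finset (ℂ × ℂ), (∀ p ∈ S, p.1.re = p.2.re ∨ p.1.im = p.2.im) ∧
        frontier R.carrier ⊆ ⋃ p ∈ S, segment ℝ p.1 p.2)) →
    (∀ (R : Literature.Probability.RandomPlanarGeometry.ConformalRectangle) (A k : ℕ), 1 ≤ A → 2 ≤ k →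
      R.carrier = (Set.Ioo (0 : ℝ) A ×ℂ Set.Ioo (0 : ℝ) 1) →
      R.arc 0 = {z : ℂ | z.re = 0 ∧ z.im ∈ Set.Icc (0 : ℝ) 1} →
      R.arc 2 = {z : ℂ | z.re = A ∧ z.im ∈ Set.Icc (0 : ℝ) 1} →
      Literature.Probability.Percolation.bondDomainCrossingProb R (1 / (k : ℝ)) =
        Literature.Probability.Percolation.crossingProb Literature.Probability.Percolation.half (A * k - 2) (k - 2)) →
    Summit.CriticalPhenomena.CardyFormulaZ2.Theses.CardyBoundaryCoulombGas.RectilinearCardy →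
    ∀ A : ℕ, 1 ≤ A → Filter.Tendsto (fun k : ℕ ↦
      Literature.Probability.Percolation.crossingProb Literature.Probability.Percolation.half (A * k - 2) (k - 2))
      Filter.atTop (nhds (Literature.Probability.RandomPlanarGeometry.cardyFunction
        (Literature.Probability.RandomPlanarGeometry.KlebanZagier.lamR A))) := by
  intro hbox hdict hRC A hA
  obtain ⟨R, hcar, harc0, harc2, hpt, hS⟩ := hbox A hA
  -- crux 4 on the rectilinear box, evaluated at a uniformizing datum
  have hlim : R.HasCrossingLimit (bondDomainCrossingProb R) cardyFunction := hRC R hS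
  obtain ⟨φ, x, hφx⟩ := MarkedDomain.exists_isUniformizing_holds R
  have hA' : (0 : ℝ) < A := by exact_mod_cast hA
  -- the modulus of the corner-marked box `(0,A)×(0,1)` is `λ(iA)`
  have hcr : crossRatio x = KlebanZagier.lamR A := by
    have h := rectangle_crossRatio_eq_lamR R (w := (A : ℝ)) (h := 1) hA' one_pos hcar hpt φ x hφx
    rwa [div_one] at h
  have ht : Tendsto (fun k : ℕ ↦ bondDomainCrossingProb R (1 / (k : ℝ))) atTop
      (𝓝 (cardyFunction (KlebanZagier.lamR A))) :=
    hcr ▸ RectCardyOneOfParts.tendsto_comp_one_div_of_hasCrossingLimit hlim hφx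
  -- replace the discretised crossing probability by the lattice one for `k ≥ 2`
  refine ht.congr' ?_
  filter_upwards [eventually_ge_atTop 2] with k hk
  exact hdict R A k hA hk hcar harc0 harc2

end Summit.CriticalPhenomena.CardyFormulaZ2.Cruxes.StripClusterRates.TwoClusterRateIsStationaryGap

end
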